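import Literature.AlgebraicGeometry.Frobenioids.PerfectionProofs
import HarnessLib

/-!
# Frobenioids I, Proposition 3.2 (ii) for THE perfection: co-angular arrows, LB-invertible arrows and
# arrows of Frobenius type are preserved by `C → C^pf`

Mochizuki, *The geometry of Frobenioids I: the general theory*, Kyushu J. Math. **62** (2008)
293–400, Proposition 3.2 (ii) p. 59 [cite: MochizukiFrdI2008, Prop. 3.2 (ii) p.59].  Printed, Prop. 3.2 (ii) is
an "if and only if" between the classes of arrows of `C` (co-angular, LB-invertible, of Frobenius type, …)
and those of their images in `C^pf`; this file proves the PRESERVATION direction `C → C^pf` only (paraphrase,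
not a quotation; the reflection direction is not treated here).

PROOF-ONLY companion of `PerfectionProofs.lean`.  The point (the others being formal): a factorisation
`γ ≫ β ≫ α` in `C^pf` of the image of `φ : A → B`, with `α` linear, `β` an isometric pre-step and `α` or
`γ` a base-isomorphism, is represented — at a common quadruple level, after one more transport — by a
factorisation in `C` of a Frobenius-conjugate `φ_N` of `φ` (`frob_A ≫ φ_N = φ ≫ frob_B`) with the same
properties (degrees and `Base` up to the isomorphisms `Base(frob)`, divisors up to the injective maps
`Φ(Base A) → Φ(Base A)^pf`, `Φ` being sharp); `φ_N` is co-angular by Prop. 1.10 (i)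
(`IsCoAngular.frobeniusConjugate`), so the middle representative is an isomorphism of `C`, hence its class
an isomorphism of `C^pf`.  With `PerfectionProofs.lean` this completes the named statement `Prop32ii` of
`BaseCategoryTheoreticityDefs.lean` for the datum `PreFrobenioidData.perfection hF`
(`prop32ii_perfection`).

DISCLOSURE (hypothesis dropped, a proved generalisation).  Print constructs `C^pf` under the STANDING HYPOTHESIS
"Suppose that the Frobenioid `C` is of Frobenius-isotropic type" (Def. 3.1 (iii) p. 56, restated in the
preamble of Prop. 3.2, p. 58); this chain (`PerfectionFrobPow`, `Perfection`, `PerfectionCategory`,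
`PerfectionOps`, `PerfectionProofs`, `PerfectionCoAngular`) works over a bare Frobenioid `hF : IsFrobenioid F`
— the construction and Prop. 3.2 (i)(ii) need nothing more, so the printed instances follow a fortiori; the
hypothesis is used (and assumed) only where print needs it, for the isotropic-type clause of Prop. 3.2 (iii)
(`PerfectionIsotropic.lean`).
-/

namespace Literature.AlgebraicGeometry.Frobenioids

namespace PreFrobenioid

namespace Perfection

open CategoryTheory Opposite

universe w v v' u u'

variable {D : Type u} [Category.{v} D] {Φ : Dᵒᵖ ⥤ CommMonCat.{w}}
  {C : Type u'} [Category.{v'} C] {F : C ⥤ ElemFrobenioid Φ} {hF : IsFrobenioid F}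
  {X Y : Perfection hF}

/-! ### Reading off properties of a representative -/

/-- `Base` of the arrow of a representative in terms of `Base` of its class.
[cite: MochizukiFrdI2008, Prop. 3.2 (i) p.58] -/
theorem base_hom_eq (r : Rep X Y) :
    Base F r.hom = baseInvFrob hF X.obj r.L.a ≫ r.baseMap ≫ Base F (frob hF Y.obj r.L.b) := by
  unfold Rep.baseMap
  simp only [Category.assoc, baseInvFrob_base_frob_assoc, baseInvFrob_base_frob, Category.comp_id]

/-- The arrow of a representative is a base-isomorphism iff its class is.
[cite: MochizukiFrdI2008, Prop. 3.2 (ii) p.59] -/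
theorem isIso_base_hom_iff (r : Rep X Y) : IsIso (Base F r.hom) ↔ IsIso r.baseMap := by
  haveI := isIso_base_frob hF X.obj r.L.a
  haveI := isIso_base_frob hF Y.obj r.L.b
  constructor
  · intro h
    unfold Rep.baseMap baseInvFrob
    infer_instance
  · intro h
    rw [base_hom_eq]
    unfold baseInvFrob
    infer_instance

/-- The arrow of a representative is an isometry iff the perfected divisor of its class vanishes
(`Φ(Base A)` is sharp, so `Φ(Base A) → Φ(Base A)^pf` reflects `1`, and `(frob_A)^*` is bijective).
[cite: MochizukiFrdI2008, Prop. 3.2 (ii) p.59] -/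
theorem div_eq_one_iff (r : Rep X Y) : r.div = 1 ↔ Div F r.hom = 1 := by
  haveI := isIso_base_frob hF X.obj r.L.a
  unfold Rep.div
  rw [Frobenioids.Perfection.mk_eq_one_iff_of_isSharp (hF.isPreFrobenioid.isDivisorial _).isSharp]
  constructor
  · intro h
    have := congrArg (pull Φ (inv (Base F (frob hF X.obj r.L.a)))) h
    rwa [← pull_comp, IsIso.inv_hom_id, pull_id, map_one] at this
  · intro h
    rw [h, map_one]

/-- A representative whose arrow is an isomorphism of `C` has an invertible class in `C^pf` (inverse at
the transposed level). [cite: MochizukiFrdI2008, Def. 3.1 (iii) p.57] -/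
theorem isIso_mk_of_isIso (r : Rep X Y) (h : IsIso r.hom) : IsIso (X := X) (Y := Y) (Hom.mk r) := by
  obtain ⟨⟨a, b, eq⟩, ρ⟩ := r
  haveI : IsIso ρ := h
  let r' : Rep Y X := ⟨⟨b, a, eq.symm⟩, inv ρ⟩
  let T : Level₃ X Y X := ⟨a, b, a, eq, eq.symm⟩
  let T' : Level₃ Y X Y := ⟨b, a, b, eq.symm, eq⟩
  refine ⟨Hom.mk r', ?_, ?_⟩
  · change Hom.comp (Hom.mk _) (Hom.mk r') = Hom.mk (Rep.id X)
    rw [Hom.mk_comp_mk, ← mk_compAt T ⟨⟨a, b, eq⟩, ρ⟩ r' (Level.le_rfl _) (Level.le_rfl _)]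
    apply Hom.mk_eq_mk.mpr
    refine ⟨T.out, Level.le_rfl _, ⟨one_dvd _, one_dvd _⟩, ?_⟩
    unfold compAt Rep.id
    rw [Level.lift_rfl, Level.lift_rfl, Level.lift_rfl, IsIso.hom_inv_id]
    unfold Level.lift
    rw [liftLevel_id]
  · change Hom.comp (Hom.mk r') (Hom.mk _) = Hom.mk (Rep.id Y)
    rw [Hom.mk_comp_mk, ← mk_compAt T' r' ⟨⟨a, b, eq⟩, ρ⟩ (Level.le_rfl _) (Level.le_rfl _)]
    apply Hom.mk_eq_mk.mpr
    refine ⟨T'.out, Level.le_rfl _, ⟨one_dvd _, one_dvd _⟩, ?_⟩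
    unfold compAt Rep.id
    rw [Level.lift_rfl, Level.lift_rfl, Level.lift_rfl, IsIso.inv_hom_id]
    unfold Level.lift
    rw [liftLevel_id]

/-! ### Co-angular arrows -/

/-- A perfected morphism all of whose (sufficiently transported) representatives are co-angular arrows of
`C` is co-angular in `C^pf`: a factorisation `γ ≫ β ≫ α` of its class with `α` linear, `β` an isometric
pre-step and `α` or `γ` a base-isomorphism is represented, at a common quadruple level and after one more
transport, by such a factorisation in `C` of a transported representative.
[cite: MochizukiFrdI2008, Prop. 3.2 (ii) p.59] -/
theorem isCoAngular_mk (r : Rep X Y)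
    (hr : ∀ (L : Level X Y) (h : r.L.LE L), PreFrobenioid.IsCoAngular F (Level.lift r.L L h r.hom)) :
    (ops hF).IsCoAngular (X := X) (Y := Y) (Hom.mk r) := by
  intro X' Y' γ β α e hα hβ hbi
  obtain ⟨g, rfl⟩ := Hom.mk_surjective γ
  obtain ⟨b, rfl⟩ := Hom.mk_surjective β
  obtain ⟨a, rfl⟩ := Hom.mk_surjective α
  -- a common quadruple level `(a₀, b₀, c₀, d₀)` for `X → X' → Y' → Y`
  let a₀ : ℕ+ := g.L.a * b.L.a * a.L.a
  let b₀ : ℕ+ := g.L.b * b.L.a * a.L.a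
  let c₀ : ℕ+ := b.L.b * g.L.b * a.L.a
  let d₀ : ℕ+ := a.L.b * (b.L.b * g.L.b)
  have eq₁ : X.idx * a₀ = X'.idx * b₀ := by
    change X.idx * (g.L.a * b.L.a * a.L.a) = X'.idx * (g.L.b * b.L.a * a.L.a)
    calc X.idx * (g.L.a * b.L.a * a.L.a) = X.idx * g.L.a * (b.L.a * a.L.a) := by ac_rfl
      _ = X'.idx * g.L.b * (b.L.a * a.L.a) := by rw [g.L.eq]
      _ = X'.idx * (g.L.b * b.L.a * a.L.a) := by ac_rfl
  have eq₂ : X'.idx * b₀ = Y'.idx * c₀ := by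
    change X'.idx * (g.L.b * b.L.a * a.L.a) = Y'.idx * (b.L.b * g.L.b * a.L.a)
    calc X'.idx * (g.L.b * b.L.a * a.L.a) = X'.idx * b.L.a * (g.L.b * a.L.a) := by ac_rfl
      _ = Y'.idx * b.L.b * (g.L.b * a.L.a) := by rw [b.L.eq]
      _ = Y'.idx * (b.L.b * g.L.b * a.L.a) := by ac_rfl
  have eq₃ : Y'.idx * c₀ = Y.idx * d₀ := by
    change Y'.idx * (b.L.b * g.L.b * a.L.a) = Y.idx * (a.L.b * (b.L.b * g.L.b))
    calc Y'.idx * (b.L.b * g.L.b * a.L.a) = Y'.idx * a.L.a * (b.L.b * g.L.b) := by ac_rfl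
      _ = Y.idx * a.L.b * (b.L.b * g.L.b) := by rw [a.L.eq]
      _ = Y.idx * (a.L.b * (b.L.b * g.L.b)) := by ac_rfl
  let T₃ : Level₃ X' Y' Y := ⟨b₀, c₀, d₀, eq₂, eq₃⟩
  let T₄ : Level₃ X X' Y := ⟨a₀, b₀, d₀, eq₁, eq₂.trans eq₃⟩
  have hg : g.L.LE T₄.fst :=
    ⟨Dvd.intro (b.L.a * a.L.a) (show g.L.a * (b.L.a * a.L.a) = g.L.a * b.L.a * a.L.a by ac_rfl),
      Dvd.intro (b.L.a * a.L.a) (show g.L.b * (b.L.a * a.L.a) = g.L.b * b.L.a * a.L.a by ac_rfl)⟩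
  have hb : b.L.LE T₃.fst :=
    ⟨Dvd.intro (g.L.b * a.L.a) (show b.L.a * (g.L.b * a.L.a) = g.L.b * b.L.a * a.L.a by ac_rfl),
      Dvd.intro (g.L.b * a.L.a) (show b.L.b * (g.L.b * a.L.a) = b.L.b * g.L.b * a.L.a by ac_rfl)⟩
  have ha : a.L.LE T₃.snd := ⟨dvd_mul_left _ _, dvd_mul_right _ _⟩
  -- the factorisation at the quadruple level
  have e' : Hom.mk ⟨T₄.out, Level.lift g.L T₄.fst hg g.hom ≫
      (Level.lift b.L T₃.fst hb b.hom ≫ Level.lift a.L T₃.snd ha a.hom)⟩ = Hom.mk r := by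
    rw [← show Hom.comp (Hom.mk g) (Hom.comp (Hom.mk b) (Hom.mk a)) = Hom.mk r from e,
      Hom.mk_comp_mk b a, ← mk_compAt T₃ b a hb ha, Hom.mk_comp_mk,
      ← mk_compAt T₄ g ⟨T₃.out, compAt T₃ b a hb ha⟩ hg (Level.le_rfl _)]
    unfold compAt
    congr 2
    rw [Level.lift_rfl]
  obtain ⟨M, hM₁, hM₂, eM⟩ := Hom.mk_eq_mk.mp e'
  -- transport once more, to the quadruple level scaled by `t := M.a * M.b`
  let t : ℕ+ := M.a * M.b
  let L₁ : Level X X' := ⟨a₀ * t, b₀ * t, by rw [← mul_assoc, eq₁, mul_assoc]⟩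
  let L₂ : Level X' Y' := ⟨b₀ * t, c₀ * t, by rw [← mul_assoc, eq₂, mul_assoc]⟩
  let L₃ : Level Y' Y := ⟨c₀ * t, d₀ * t, by rw [← mul_assoc, eq₃, mul_assoc]⟩
  let L : Level X Y := ⟨a₀ * t, d₀ * t, by rw [← mul_assoc, eq₁.trans (eq₂.trans eq₃), mul_assoc]⟩
  have h₁ : T₄.fst.LE L₁ := ⟨dvd_mul_right _ _, dvd_mul_right _ _⟩
  have h₂ : T₃.fst.LE L₂ := ⟨dvd_mul_right _ _, dvd_mul_right _ _⟩
  have h₃ : T₃.snd.LE L₃ := ⟨dvd_mul_right _ _, dvd_mul_right _ _⟩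
  have hL : T₄.out.LE L := ⟨dvd_mul_right _ _, dvd_mul_right _ _⟩
  have hML : M.LE L :=
    ⟨(Dvd.intro M.b rfl : M.a ∣ t).trans (dvd_mul_left _ _),
      (Dvd.intro M.a (mul_comm _ _) : M.b ∣ t).trans (dvd_mul_left _ _)⟩
  have hrL : r.L.LE L := hM₂.trans hML
  have eL := lift_eq_lift_of_le hM₁ hM₂ eM hML hL hrL
  -- the factorisation of the transported representative of `r`, in `C`
  have hfac : Level.lift T₄.fst L₁ h₁ (Level.lift g.L T₄.fst hg g.hom) ≫
      Level.lift T₃.fst L₂ h₂ (Level.lift b.L T₃.fst hb b.hom) ≫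
        Level.lift T₃.snd L₃ h₃ (Level.lift a.L T₃.snd ha a.hom) = Level.lift r.L L hrL r.hom := by
    have := eL
    change Level.lift T₄.out L hL (Level.lift g.L T₄.fst hg g.hom ≫
      (Level.lift b.L T₃.fst hb b.hom ≫ Level.lift a.L T₃.snd ha a.hom)) = _ at this
    rw [← this]
    unfold Level.lift
    rw [liftLevel_comp hF _ _ hL.1 h₁.2 hL.2 (Level.degFr_eq T₄.fst L₁ h₁)
        ((Level.degFr_eq T₃.fst L₂ h₂).trans (Level.degFr_eq T₃.snd L₃ h₃)),
      liftLevel_comp hF _ _ h₂.1 h₂.2 h₃.2 (Level.degFr_eq T₃.fst L₂ h₂) (Level.degFr_eq T₃.snd L₃ h₃)]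
  -- properties of the transported arrows
  have hdeg_a : PreFrobenioid.degFr F (Level.lift T₃.snd L₃ h₃ (Level.lift a.L T₃.snd ha a.hom)) = 1 :=
    (degFr_lift T₃.snd L₃ h₃ _).trans ((degFr_lift a.L T₃.snd ha a.hom).trans hα)
  have hdeg_b : PreFrobenioid.degFr F (Level.lift T₃.fst L₂ h₂ (Level.lift b.L T₃.fst hb b.hom)) = 1 :=
    (degFr_lift T₃.fst L₂ h₂ _).trans ((degFr_lift b.L T₃.fst hb b.hom).trans hβ.1.1)
  have hbase_b : IsIso (Base F (Level.lift T₃.fst L₂ h₂ (Level.lift b.L T₃.fst hb b.hom))) := by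
    apply (isIso_base_hom_iff ⟨L₂, _⟩).mpr
    have e1 := baseMap_lift T₃.fst L₂ h₂ (Level.lift b.L T₃.fst hb b.hom)
    have e2 := baseMap_lift b.L T₃.fst hb b.hom
    change IsIso (Rep.baseMap ⟨L₂, Level.lift T₃.fst L₂ h₂ (Level.lift b.L T₃.fst hb b.hom)⟩)
    rw [e1, e2]
    exact hβ.1.2
  have hdiv_b : Div F (Level.lift T₃.fst L₂ h₂ (Level.lift b.L T₃.fst hb b.hom)) = 1 := by
    apply (div_eq_one_iff ⟨L₂, _⟩).mp
    have e1 := div_lift T₃.fst L₂ h₂ (Level.lift b.L T₃.fst hb b.hom)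
    have e2 := div_lift b.L T₃.fst hb b.hom
    change Rep.div ⟨L₂, Level.lift T₃.fst L₂ h₂ (Level.lift b.L T₃.fst hb b.hom)⟩ = 1
    rw [e1, e2]
    exact hβ.2
  have hbi' : IsIso (Base F (Level.lift T₃.snd L₃ h₃ (Level.lift a.L T₃.snd ha a.hom))) ∨
      IsIso (Base F (Level.lift T₄.fst L₁ h₁ (Level.lift g.L T₄.fst hg g.hom))) := by
    rcases hbi with h | h
    · left
      apply (isIso_base_hom_iff ⟨L₃, _⟩).mpr
      have e1 := baseMap_lift T₃.snd L₃ h₃ (Level.lift a.L T₃.snd ha a.hom)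
      have e2 := baseMap_lift a.L T₃.snd ha a.hom
      change IsIso (Rep.baseMap ⟨L₃, Level.lift T₃.snd L₃ h₃ (Level.lift a.L T₃.snd ha a.hom)⟩)
      rw [e1, e2]
      exact h
    · right
      apply (isIso_base_hom_iff ⟨L₁, _⟩).mpr
      have e1 := baseMap_lift T₄.fst L₁ h₁ (Level.lift g.L T₄.fst hg g.hom)
      have e2 := baseMap_lift g.L T₄.fst hg g.hom
      change IsIso (Rep.baseMap ⟨L₁, Level.lift T₄.fst L₁ h₁ (Level.lift g.L T₄.fst hg g.hom)⟩)
      rw [e1, e2]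
      exact h
  -- co-angularity of the transported representative in `C`
  have hiso := hr L hrL _ _ _ hfac hdeg_a hdiv_b ⟨hdeg_b, hbase_b⟩ hbi'
  -- back to `C^pf`
  have : Hom.mk b = Hom.mk ⟨L₂, Level.lift T₃.fst L₂ h₂ (Level.lift b.L T₃.fst hb b.hom)⟩ := by
    rw [← Hom.mk_lift b T₃.fst hb, ← Hom.mk_lift ⟨T₃.fst, Level.lift b.L T₃.fst hb b.hom⟩ L₂ h₂]
  rw [this]
  exact isIso_mk_of_isIso _ hiso

/-- Every transport of the degree-one representative of `φ : A → B` is a Frobenius conjugate of `φ`.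
[cite: MochizukiFrdI2008, Prop. 1.10 (i) p.34] -/
theorem frob_lift_toPfRep {A B : C} (φ : A ⟶ B) (L : Level (root hF A 1) (root hF B 1))
    (h : (toPfRep hF φ).L.LE L) :
    (frob hF A 1 ≫ frobTrans hF A h.1) ≫ Level.lift (toPfRep hF φ).L L h (toPfRep hF φ).hom =
      φ ≫ (frob hF B 1 ≫ frobTrans hF B h.2) := by
  have sp := Level.lift_spec (toPfRep hF φ).L L h (toPfRep hF φ).hom
  change frobTrans hF A h.1 ≫ _ = (toPfRep hF φ).hom ≫ frobTrans hF B h.2 at sp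
  rw [Category.assoc, sp, ← Category.assoc, frob_toPfRep, Category.assoc]

/-- `C → C^pf` preserves co-angular arrows (Prop. 3.2 (ii); via Prop. 1.10 (i)).
[cite: MochizukiFrdI2008, Prop. 3.2 (ii) p.59] -/
theorem preservesMor_isCoAngular (hF : IsFrobenioid F) :
    PreFrobenioidData.PreservesMor (toPf hF) (PreFrobenioidData.ofFunctor Φ F).IsCoAngular
      (ops hF).IsCoAngular := by
  intro A B φ hφ
  have hφ' : PreFrobenioid.IsCoAngular F φ := (PreFrobenioidData.ofFunctor_isCoAngular F φ).mp hφ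
  refine isCoAngular_mk (toPfRep hF φ) fun L h => ?_
  have hαF : IsFrobeniusType F (frob hF A 1 ≫ frobTrans hF A h.1) :=
    IsFrobeniusType.comp F hF (isFrobeniusType_frob hF A 1) (isFrobeniusType_frobTrans hF A _)
  have hβF : IsFrobeniusType F (frob hF B 1 ≫ frobTrans hF B h.2) :=
    IsFrobeniusType.comp F hF (isFrobeniusType_frob hF B 1) (isFrobeniusType_frobTrans hF B _)
  have hdeg : PreFrobenioid.degFr F (frob hF A 1 ≫ frobTrans hF A h.1) =
      PreFrobenioid.degFr F (frob hF B 1 ≫ frobTrans hF B h.2) := by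
    rw [frob_frobTrans, frob_frobTrans, degFr_frob, degFr_frob]
    have := L.eq
    change 1 * L.a = 1 * L.b at this
    rwa [one_mul, one_mul] at this
  exact IsCoAngular.frobeniusConjugate hF hφ' (frob_lift_toPfRep φ L h) hαF hβF hdeg

/-- `C → C^pf` preserves LB-invertible arrows. [cite: MochizukiFrdI2008, Prop. 3.2 (ii) p.59] -/
theorem preservesMor_isLBInvertible (hF : IsFrobenioid F) :
    PreFrobenioidData.PreservesMor (toPf hF) (PreFrobenioidData.ofFunctor Φ F).IsLBInvertible
      (ops hF).IsLBInvertible :=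
  fun _ _ φ h => ⟨preservesMor_isCoAngular hF φ h.1, preservesMor_isIsometry hF φ h.2⟩

/-- `C → C^pf` preserves arrows of Frobenius type. [cite: MochizukiFrdI2008, Prop. 3.2 (ii) p.59] -/
theorem preservesMor_isFrobeniusType (hF : IsFrobenioid F) :
    PreFrobenioidData.PreservesMor (toPf hF) (PreFrobenioidData.ofFunctor Φ F).IsFrobeniusType
      (ops hF).IsFrobeniusType :=
  fun _ _ φ h => ⟨preservesMor_isLBInvertible hF φ h.1, preservesMor_isBaseIso hF φ h.2⟩

/-- **Prop. 3.2 (ii)** for THE perfection of a Frobenioid: `C → C^pf` preserves arrows of Frobenius type,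
pre-steps, base-isomorphisms, isometries, co-angular arrows, LB-invertible arrows and Frobenius degrees —
the named statement `Prop32ii` of `BaseCategoryTheoreticityDefs.lean` DISCHARGED for the datum
`PreFrobenioidData.perfection hF`. [cite: MochizukiFrdI2008, Prop. 3.2 (ii) p.59] -/
theorem prop32ii_perfection (hF : IsFrobenioid F) :
    Prop32ii (PreFrobenioidData.ofFunctor Φ F) (PreFrobenioidData.perfection hF) :=
  ⟨preservesMor_isFrobeniusType hF, preservesMor_isPreStep hF, preservesMor_isBaseIso hF,
    preservesMor_isIsometry hF, preservesMor_isCoAngular hF, preservesMor_isLBInvertible hF,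
    preservesMor_hasDegree hF⟩

end Perfection

end PreFrobenioid

end Literature.AlgebraicGeometry.Frobenioids
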